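import Mathlib
import HarnessLib
import Summits.AtomisticToContinuum.FouriersLaw.Theses.JunctionLocality
import Summits.AtomisticToContinuum.FouriersLaw.Theorems.JunctionLocalitySuperadditiveResistanceStubInsertionIdentity
import Summits.AtomisticToContinuum.FouriersLaw.Theorems.JunctionLocalitySuperadditiveResistanceStubKuboFrameAbelian
import Summits.AtomisticToContinuum.FouriersLaw.Theorems.JunctionLocalitySuperadditiveResistanceStubKuboFrameAux1

/-!
# Exact device forward field ⇔ `L²(μ_T)`-bounded resolvent fields
(helper `helper_forwardFieldIffResolventBound` toward stub `stub_kuboFrame`, line `thermalise-then-cut-probe-insertion`,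
crux stmt-AtomisticToContinuum-11748, skeleton v3.1; `--supports` stmt-AtomisticToContinuum-11748)

Device: the `(N+M)`-chain `pinnedChain ω₂ lam β γ` with two extra friction-`γ` thermostats on `p_{N−1}, p_N`, all
terminals at `T`; `L_dev = X_H + γ S_B` (`B = deviceWeight N M`), Gibbs state `μ_T`, terminal observable `k = p_s² − T`,
κ-resolvent fields `g_κ ∈ C² ∩ L²(μ_T)`, `κ g_κ − L_dev g_κ = k` (`κ > 0`, landed `exists_deviceResolventField`). THE
EQUIVALENCE proved here pins the fixed-`N` input of `stub_kuboFrame` (existence of the device's forward fields, four of the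
five clauses of `IsForwardField`) to ONE resolvent bound:

  `(∃ C, ∀ κ ∈ (0,1], ∫ g_κ² dμ_T ≤ C) ↔ (∃ gb ∈ C² ∩ L²(μ_T), ∫ gb dμ_T = 0, L_dev gb = −k pointwise)`.

`⇐`: `(κ − L_dev)(g_κ − gb) = −κ gb`, so `‖g_κ − gb‖ ≤ ‖gb‖` by the landed dissipative bound `resolvent_sq_bound`.
`⇒` (Banach–Alaoglu, no semigroup): the classes `[g_κ]`, `κ ∈ (0,1]`, lie in a closed ball of the Hilbert space `L²(μ_T)`,
weak-* compact in its dual (`WeakDual.isCompact_closedBall`); a cluster point `g_cl` of `κ → 0⁺` inherits every convergent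
pairing: `⟨g_κ, 1⟩ = 0` (landed `integral_resolvent_mul_gibbsDensity`) and `⟨g_κ, L_dev^† f⟩ = κ⟨g_κ, f⟩ − ⟨k, f⟩ → −⟨k, f⟩`
(landed `integral_adjointOp_mul_resolvent`), so `g_cl` is a mean-zero weak `L²(μ_T)` solution of `L_dev g = −k`, made
classical by the landed hypoelliptic regularity `helper_dffForwardFieldOfWeak`. What remains for `stub_kuboFrame` is thus
exactly the `κ`-uniform `L²(μ_T)` bound (quantitative ergodicity of the four-thermostat device, Cuneo–Eckmann–Hairer–Rey-Bellet
2018 Thm 2.13(3) network form) plus `S_K gb ∈ L²(μ_T)` for the end fields: `stub_kuboFrame_of_resolventBound` records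
exactly this — the registered `stub_kuboFrame` follows from (R1) an `L²(μ_T)` bound, uniform in `κ ∈ (0,1]`, on the
κ-resolvent fields of the four terminal observables and (R2) `S_K gb ∈ L²(μ_T)` for the classical end forward fields
(resolvent fields by the landed `exists_deviceResolventField`, the frame by the landed `kuboFrame_kuboMatrix`).
No definitions; standard axioms.
-/

noncomputable section

open MeasureTheory Filter Topology ProbabilityTheory
open scoped ContDiff NNReal InnerProductSpace
open Literature.MathematicalPhysics.KineticTheory.HeatConduction

namespace Summit.AtomisticToContinuum.FouriersLaw.Cruxes.SuperadditiveResistance.ThermaliseThenCutProbeInsertion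

section Equivalence

open Summit.AtomisticToContinuum.FouriersLaw.Theorems.SuperadditiveResistance
open Summit.AtomisticToContinuum.FouriersLaw.Theorems.SuperadditiveResistance.Kubo
  (memLp_kinetic integral_kinetic_mul_gibbsDensity integrable_sq_mul_gibbsDensity)
open Summit.AtomisticToContinuum.FouriersLaw.Theorems.SuperadditiveResistance.DeviceLiouville
  (liouvilleOp bathOp deviceWeight deviceGenerator_eq kin_eq_sq liouvilleOp_sub bathOp_sub)
open Summit.AtomisticToContinuum.FouriersLaw.Cruxes.SuperadditiveResistance.FloatingProbeBypassLaplacian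
  (helper_dffForwardFieldOfWeak inner_toLp_left inner_toLp_toLp norm_toLp_sq memLp_two_of_hasCompactSupport
    continuous_genOp hasCompactSupport_genOp)

variable {ω₂ lam β γ : ℝ}

/-- **HELPER (C) — exact forward field ⇔ bounded resolvent fields** (registered helper of stub `stub_kuboFrame`, line
`thermalise-then-cut-probe-insertion`). For the γ-probed device of `pinnedChain ω₂ lam β γ` at temperature `T`
(`N, M ≥ 2`, `s < N + M`) and a family of κ-resolvent fields `g_κ ∈ C² ∩ L²(μ_T)`, `κ g_κ − L_dev g_κ = p_s² − T`
(`κ > 0`): the family is bounded in `L²(μ_T)` for `κ ∈ (0,1]` iff the device has a classical mean-zero forward field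
`gb ∈ C² ∩ L²(μ_T)`, `L_dev gb = −(p_s² − T)`. -/
theorem helper_forwardFieldIffResolventBound :
    ∀ (ω₂ lam β γ T : ℝ), 0 < ω₂ → 0 < lam → 0 < β → 0 < γ → 0 < T →
      ∀ (N M : ℕ), 2 ≤ N → 2 ≤ M → ∀ (s : ℕ), s < N + M →
      ∀ (g : ℝ → PhaseSpace (N + M) → ℝ),
        (∀ κ : ℝ, 0 < κ → ContDiff ℝ 2 (g κ) ∧
          MemLp (g κ) 2 ((pinnedChain ω₂ lam β γ).gibbsMeasure (N + M) T) ∧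
          ∀ x, κ * g κ x - deviceGenerator (pinnedChain ω₂ lam β γ) N M (fun _ => T) (g κ) x =
            kin (N + M) s x - T) →
      ((∃ C : ℝ, ∀ κ : ℝ, 0 < κ → κ ≤ 1 →
          ∫ x, g κ x ^ 2 ∂((pinnedChain ω₂ lam β γ).gibbsMeasure (N + M) T) ≤ C) ↔
        ∃ gb : PhaseSpace (N + M) → ℝ, ContDiff ℝ 2 gb ∧
          MemLp gb 2 ((pinnedChain ω₂ lam β γ).gibbsMeasure (N + M) T) ∧
          ∫ x, gb x ∂((pinnedChain ω₂ lam β γ).gibbsMeasure (N + M) T) = 0 ∧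
          ∀ x, deviceGenerator (pinnedChain ω₂ lam β γ) N M (fun _ => T) gb x = -(kin (N + M) s x - T)) := by
  intro ω₂ lam β γ T hω hl hβ hγ hT N M hN hM s hs g hg
  -- the setting
  set P := pinnedChain ω₂ lam β γ with hP
  have hL : 0 < N + M := by omega
  haveI : IsProbabilityMeasure (P.gibbsMeasure (N + M) T) :=
    pinnedChain_isProbabilityMeasure_gibbsMeasure hω hl.le hβ.le γ (N + M) hT
  have hU1 : ContDiff ℝ 1 P.U := pinnedChain_contDiff_U ω₂ lam β γ
  have hV1 : ContDiff ℝ 1 P.V := pinnedChain_contDiff_V ω₂ lam β γ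
  have hB : ∀ i, 0 ≤ deviceWeight N M i := fun i => by
    unfold DeviceLiouville.deviceWeight OscillatorChain.bathWeight; split_ifs <;> norm_num
  have hZ : 0 < ∫ x, P.gibbsDensity (N + M) T x :=
    integral_exp_pos (pinnedChain_integrable_gibbsDensity hω hl.le hβ.le γ (N + M) hT)
  have hC2 : ∀ κ, 0 < κ → ContDiff ℝ 2 (g κ) := fun κ hκ => (hg κ hκ).1
  have hL2 : ∀ κ, 0 < κ → MemLp (g κ) 2 (P.gibbsMeasure (N + M) T) := fun κ hκ => (hg κ hκ).2.1
  have hk2 : MemLp (fun y : PhaseSpace (N + M) => y.2 ⟨s, hs⟩ ^ 2 - T) 2 (P.gibbsMeasure (N + M) T) :=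
    memLp_kinetic hω hl.le hβ.le (N + M) hT ⟨s, hs⟩
  have hconv : ∀ (f : PhaseSpace (N + M) → ℝ) (x : PhaseSpace (N + M)),
      deviceGenerator P N M (fun _ => T) f x =
        liouvilleOp P (N + M) f x + γ * bathOp (N + M) (deviceWeight N M) T f x := fun f x => by
    rw [show deviceGenerator P N M (fun _ => T) f x = DeviceLiouville.deviceGenerator P N M (fun _ => T) f x from rfl,
      deviceGenerator_eq, show P.γ = γ from rfl]
  have hkin : ∀ x : PhaseSpace (N + M), kin (N + M) s x = x.2 ⟨s, hs⟩ ^ 2 := fun x => by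
    rw [show kin (N + M) s x = DeviceLiouville.kin (N + M) s x from rfl, kin_eq_sq hs]
  have hpair : ∀ κ, 0 < κ → ∀ x, 1 * liouvilleOp P (N + M) (g κ) x +
      γ * bathOp (N + M) (deviceWeight N M) T (g κ) x = -((x.2 ⟨s, hs⟩ ^ 2 - T) - κ * g κ x) := by
    intro κ hκ x
    have e := (hg κ hκ).2.2 x
    rw [hconv, hkin] at e
    linarith
  have hev : ∀ᶠ κ in 𝓝[>] (0 : ℝ), 0 < κ := eventually_mem_nhdsWithin
  constructor
  · -- `⇒`: Banach–Alaoglu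
    rintro ⟨C, hC⟩
    have hmean : ∀ κ, 0 < κ → ∫ x, g κ x ∂(P.gibbsMeasure (N + M) T) = 0 := by
      intro κ hκ
      have h := integral_resolvent_mul_gibbsDensity hω hl.le hβ.le (N + M) hT (deviceWeight N M) hB 1 hγ κ
        (hC2 κ hκ) (hL2 κ hκ) hk2 (hpair κ hκ)
      rw [integral_kinetic_mul_gibbsDensity (γ := γ) hω hl.le hβ.le (N + M) hT ⟨s, hs⟩] at h
      rw [P.integral_gibbsMeasure, (mul_eq_zero.1 h).resolve_left hκ.ne', mul_zero]
    -- the classes `G κ = [g_κ]` and their bound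
    set G : ℝ → Lp ℝ 2 (P.gibbsMeasure (N + M) T) := fun κ =>
      if h : 0 < κ then (hL2 κ h).toLp (g κ) else 0 with hGdef
    have hGpos : ∀ κ (hκ : 0 < κ), G κ = (hL2 κ hκ).toLp (g κ) := fun κ hκ => by simp only [hGdef, dif_pos hκ]
    set R : ℝ := Real.sqrt C with hR
    have hGnorm : ∀ κ, 0 < κ → κ ≤ 1 → ‖G κ‖ ≤ R := by
      intro κ hκ hκ1
      have h1 : ‖G κ‖ ^ 2 ≤ C := by rw [hGpos κ hκ, norm_toLp_sq]; exact hC κ hκ hκ1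
      simpa only [abs_of_nonneg (norm_nonneg _)] using Real.abs_le_sqrt h1
    -- weak-* compactness of the ball and a cluster point of `κ → 0⁺`
    set Φ : ℝ → WeakDual ℝ (Lp ℝ 2 (P.gibbsMeasure (N + M) T)) := fun κ =>
      StrongDual.toWeakDual (InnerProductSpace.toDual ℝ (Lp ℝ 2 (P.gibbsMeasure (N + M) T)) (G κ)) with hΦdef
    have hΦapply : ∀ κ (u : Lp ℝ 2 (P.gibbsMeasure (N + M) T)), Φ κ u = ⟪G κ, u⟫_ℝ := fun κ u => rfl
    have hK : IsCompact (WeakDual.toStrongDual ⁻¹' Metric.closedBall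
        (0 : StrongDual ℝ (Lp ℝ 2 (P.gibbsMeasure (N + M) T))) R) := WeakDual.isCompact_closedBall 0 R
    have hFK : Filter.map Φ (𝓝[>] 0) ≤ 𝓟 (WeakDual.toStrongDual ⁻¹' Metric.closedBall
        (0 : StrongDual ℝ (Lp ℝ 2 (P.gibbsMeasure (N + M) T))) R) := by
      refine Filter.le_principal_iff.2 (Filter.mem_map.2 ?_)
      filter_upwards [Ioc_mem_nhdsGT zero_lt_one] with κ hκ
      show WeakDual.toStrongDual (Φ κ) ∈ Metric.closedBall _ R
      rw [mem_closedBall_zero_iff]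
      show ‖InnerProductSpace.toDual ℝ (Lp ℝ 2 (P.gibbsMeasure (N + M) T)) (G κ)‖ ≤ R
      rw [LinearIsometryEquiv.norm_map]
      exact hGnorm κ hκ.1 hκ.2
    obtain ⟨x, -, hx⟩ := hK.exists_clusterPt hFK
    set gcl : Lp ℝ 2 (P.gibbsMeasure (N + M) T) :=
      (InnerProductSpace.toDual ℝ (Lp ℝ 2 (P.gibbsMeasure (N + M) T))).symm (WeakDual.toStrongDual x) with hgcl_def
    have hgcl : ∀ u : Lp ℝ 2 (P.gibbsMeasure (N + M) T), ⟪gcl, u⟫_ℝ = x u := fun u => by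
      rw [hgcl_def, ← InnerProductSpace.toDual_apply_apply (𝕜 := ℝ), LinearIsometryEquiv.apply_symm_apply]
      rfl
    -- a cluster point inherits every convergent pairing
    have key : ∀ (u : Lp ℝ 2 (P.gibbsMeasure (N + M) T)) (c : ℝ),
        Tendsto (fun κ => ⟪G κ, u⟫_ℝ) (𝓝[>] 0) (𝓝 c) → ⟪gcl, u⟫_ℝ = c := by
      intro u c hc
      have h1 : ClusterPt (x u) (Filter.map (fun y : WeakDual ℝ (Lp ℝ 2 (P.gibbsMeasure (N + M) T)) => y u)
          (Filter.map Φ (𝓝[>] 0))) :=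
        hx.map (WeakDual.eval_continuous u).continuousAt tendsto_map
      rw [Filter.map_map] at h1
      have h2 : Filter.map ((fun y : WeakDual ℝ (Lp ℝ 2 (P.gibbsMeasure (N + M) T)) => y u) ∘ Φ) (𝓝[>] 0) ≤
          𝓝 c := by
        have : ((fun y : WeakDual ℝ (Lp ℝ 2 (P.gibbsMeasure (N + M) T)) => y u) ∘ Φ) = fun κ => ⟪G κ, u⟫_ℝ :=
          funext fun κ => hΦapply κ u
        rw [this]
        exact hc
      rw [hgcl]
      exact eq_of_nhds_neBot (h1.mono h2).neBot
    -- mean zero of the cluster point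
    have h1mem : MemLp (fun _ : PhaseSpace (N + M) => (1 : ℝ)) 2 (P.gibbsMeasure (N + M) T) := memLp_const 1
    have hmean_cl : ∫ y, gcl y ∂(P.gibbsMeasure (N + M) T) = 0 := by
      have h := key (h1mem.toLp _) 0 (by
        refine (tendsto_const_nhds (x := (0 : ℝ))).congr' ?_
        filter_upwards [hev] with κ hκ
        rw [hGpos κ hκ, inner_toLp_toLp]
        simp [hmean κ hκ])
      rw [real_inner_comm, inner_toLp_left] at h
      simpa using h
    -- the weak equation of the cluster point
    have hNmem : ∀ (f : PhaseSpace (N + M) → ℝ), ContDiff ℝ ∞ f → HasCompactSupport f →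
        MemLp (fun x => (-1) * liouvilleOp P (N + M) f x + γ * bathOp (N + M) (deviceWeight N M) T f x + 0 * f x)
          2 (P.gibbsMeasure (N + M) T) := fun f hf hfc =>
      memLp_two_of_hasCompactSupport _ (continuous_genOp hU1 hV1 (N + M) (-1) γ 0 (deviceWeight N M) T
        (hf.of_le (by norm_cast)))
        (hasCompactSupport_genOp (N + M) (-1) γ 0 (deviceWeight N M) T (hf.of_le (by norm_cast)) hfc)
    have hweak_cl : ∀ φ : PhaseSpace (N + M) → ℝ, ContDiff ℝ ∞ φ → HasCompactSupport φ →
        ∫ y, (-DeviceLiouville.liouvilleOp P (N + M) φ y +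
            γ * DeviceLiouville.bathOp (N + M) (DeviceLiouville.deviceWeight N M) T φ y) * gcl y
          ∂(P.gibbsMeasure (N + M) T) =
        ∫ y, -(DeviceLiouville.kin (N + M) s y - T) * φ y ∂(P.gibbsMeasure (N + M) T) := by
      intro φ hφ hφc
      have hφ2 : ContDiff ℝ 2 φ := hφ.of_le (by norm_cast)
      have hφL2 : MemLp φ 2 (P.gibbsMeasure (N + M) T) := memLp_two_of_hasCompactSupport _ hφ.continuous hφc
      have hform : ∀ᶠ κ in 𝓝[>] (0 : ℝ), ⟪G κ, (hNmem φ hφ hφc).toLp _⟫_ℝ =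
          κ * ⟪G κ, hφL2.toLp φ⟫_ℝ - ∫ y, φ y * (y.2 ⟨s, hs⟩ ^ 2 - T) ∂(P.gibbsMeasure (N + M) T) := by
        filter_upwards [hev] with κ hκ
        rw [hGpos κ hκ, inner_toLp_toLp, inner_toLp_toLp]
        have hadj := integral_adjointOp_mul_resolvent hω hl.le hβ.le (N + M) hT (deviceWeight N M) 1 γ κ hφ2 hφc
          (hC2 κ hκ) (hL2 κ hκ) hk2 (hpair κ hκ)
        have e1 : ∫ y, g κ y * ((-1) * liouvilleOp P (N + M) φ y + γ * bathOp (N + M) (deviceWeight N M) T φ y +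
            0 * φ y) ∂(P.gibbsMeasure (N + M) T) =
            ∫ y, (-1 * liouvilleOp P (N + M) φ y + γ * bathOp (N + M) (deviceWeight N M) T φ y + 0 * φ y) *
              g κ y ∂(P.gibbsMeasure (N + M) T) :=
          integral_congr_ae (ae_of_all _ fun y => by ring)
        have e2 : ∫ y, φ y * g κ y ∂(P.gibbsMeasure (N + M) T) = ∫ y, g κ y * φ y ∂(P.gibbsMeasure (N + M) T) :=
          integral_congr_ae (ae_of_all _ fun y => by ring)
        rw [e1, hadj, e2]
      have hlim1 : Tendsto (fun κ : ℝ => κ * ⟪G κ, hφL2.toLp φ⟫_ℝ) (𝓝[>] 0) (𝓝 0) := by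
        refine squeeze_zero_norm' (a := fun κ : ℝ => |κ| * (R * ‖hφL2.toLp φ‖)) ?_ ?_
        · filter_upwards [Ioc_mem_nhdsGT zero_lt_one] with κ hκ
          rw [Real.norm_eq_abs, abs_mul]
          refine mul_le_mul_of_nonneg_left ?_ (abs_nonneg κ)
          exact (abs_real_inner_le_norm _ _).trans (mul_le_mul_of_nonneg_right (hGnorm κ hκ.1 hκ.2) (norm_nonneg _))
        · refine tendsto_nhdsWithin_of_tendsto_nhds ?_
          simpa using ((continuous_abs.tendsto (0 : ℝ)).mul_const (R * ‖hφL2.toLp φ‖))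
      have hlim : Tendsto (fun κ => ⟪G κ, (hNmem φ hφ hφc).toLp _⟫_ℝ) (𝓝[>] 0)
          (𝓝 (-∫ y, φ y * (y.2 ⟨s, hs⟩ ^ 2 - T) ∂(P.gibbsMeasure (N + M) T))) := by
        have := hlim1.sub (tendsto_const_nhds (x := ∫ y, φ y * (y.2 ⟨s, hs⟩ ^ 2 - T) ∂(P.gibbsMeasure (N + M) T)))
        rw [zero_sub] at this
        exact this.congr' (hform.mono fun κ h => h.symm)
      have hval := key _ _ hlim
      rw [real_inner_comm, inner_toLp_left] at hval
      have e3 : ∫ y, (-DeviceLiouville.liouvilleOp P (N + M) φ y +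
            γ * DeviceLiouville.bathOp (N + M) (DeviceLiouville.deviceWeight N M) T φ y) * gcl y
            ∂(P.gibbsMeasure (N + M) T) =
          ∫ y, (-1 * liouvilleOp P (N + M) φ y + γ * bathOp (N + M) (deviceWeight N M) T φ y + 0 * φ y) * gcl y
            ∂(P.gibbsMeasure (N + M) T) :=
        integral_congr_ae (ae_of_all _ fun y => by ring)
      have e4 : ∫ y, -(DeviceLiouville.kin (N + M) s y - T) * φ y ∂(P.gibbsMeasure (N + M) T) =
          -∫ y, φ y * (y.2 ⟨s, hs⟩ ^ 2 - T) ∂(P.gibbsMeasure (N + M) T) := by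
        rw [← integral_neg]
        exact integral_congr_ae (ae_of_all _ fun y => by simp only [kin_eq_sq hs]; ring)
      rw [e3, hval, e4]
    obtain ⟨g', ⟨hg'C, hg'L2, hg'mean, hg'pde⟩, -⟩ := helper_dffForwardFieldOfWeak ω₂ lam β γ hω hl.le hβ.le hγ T hT
      N M hL s gcl (Lp.memLp gcl) hmean_cl hweak_cl
    exact ⟨g', hg'C, hg'L2, hg'mean, fun y => hg'pde y⟩
  · -- `⇐`: `(κ − L_dev)(g_κ − gb) = −κ gb` and the dissipative bound
    rintro ⟨gb, hgbC, hgbL2, -, hgbpde⟩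
    refine ⟨4 * ∫ x, gb x ^ 2 ∂(P.gibbsMeasure (N + M) T), fun κ hκ _ => ?_⟩
    have hpde_gb : ∀ x, liouvilleOp P (N + M) gb x + γ * bathOp (N + M) (deviceWeight N M) T gb x =
        -(x.2 ⟨s, hs⟩ ^ 2 - T) := fun x => by rw [← hconv, ← hkin]; exact hgbpde x
    have hw : ∀ x, 1 * liouvilleOp P (N + M) (fun y => g κ y - gb y) x +
        γ * bathOp (N + M) (deviceWeight N M) T (fun y => g κ y - gb y) x =
        -((-κ * gb x) - κ * (g κ x - gb x)) := by
      intro x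
      rw [liouvilleOp_sub ((hC2 κ hκ).differentiable two_ne_zero) (hgbC.differentiable two_ne_zero),
        bathOp_sub (hC2 κ hκ) hgbC]
      have e1 := hpair κ hκ x
      have e2 := hpde_gb x
      linarith
    have hbd := resolvent_sq_bound hω hl.le hβ.le (N + M) hT (deviceWeight N M) hB 1 hγ hκ ((hC2 κ hκ).sub hgbC)
      ((hL2 κ hκ).sub hgbL2) (hgbL2.const_mul (-κ)) hw
    -- `hbd : κ² ∫ (g_κ − gb)² ρ ≤ ∫ (−κ gb)² ρ`
    have hI1 := integrable_sq_mul_gibbsDensity hω hl.le hβ.le γ (N + M) hT ((hL2 κ hκ).sub hgbL2)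
    have hI2 := integrable_sq_mul_gibbsDensity hω hl.le hβ.le γ (N + M) hT hgbL2
    have hI3 := integrable_sq_mul_gibbsDensity hω hl.le hβ.le γ (N + M) hT (hL2 κ hκ)
    have e1 : ∫ x, (-κ * gb x) ^ 2 * P.gibbsDensity (N + M) T x =
        κ ^ 2 * ∫ x, gb x ^ 2 * P.gibbsDensity (N + M) T x := by
      rw [← integral_const_mul]
      exact integral_congr_ae (ae_of_all _ fun x => by ring)
    rw [e1] at hbd
    have hbd' : ∫ x, (g κ - gb) x ^ 2 * P.gibbsDensity (N + M) T x ≤ ∫ x, gb x ^ 2 * P.gibbsDensity (N + M) T x :=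
      le_of_mul_le_mul_left hbd (by positivity)
    -- `g² ≤ 2 (g − gb)² + 2 gb²`
    have hpt : ∫ x, g κ x ^ 2 * P.gibbsDensity (N + M) T x ≤
        ∫ x, (2 * ((g κ - gb) x ^ 2 * P.gibbsDensity (N + M) T x) + 2 * (gb x ^ 2 * P.gibbsDensity (N + M) T x)) := by
      refine integral_mono hI3 ((hI1.const_mul 2).add (hI2.const_mul 2)) fun x => ?_
      have hρ := (P.gibbsDensity_pos (N + M) T x).le
      have h0 : g κ x ^ 2 ≤ 2 * (g κ - gb) x ^ 2 + 2 * gb x ^ 2 := by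
        simp only [Pi.sub_apply]
        nlinarith [sq_nonneg (g κ x - 2 * gb x)]
      calc g κ x ^ 2 * P.gibbsDensity (N + M) T x ≤ (2 * (g κ - gb) x ^ 2 + 2 * gb x ^ 2) * P.gibbsDensity (N + M) T x :=
            mul_le_mul_of_nonneg_right h0 hρ
        _ = _ := by ring
    rw [integral_add (hI1.const_mul 2) (hI2.const_mul 2), integral_const_mul, integral_const_mul] at hpt
    rw [P.integral_gibbsMeasure, P.integral_gibbsMeasure, ← mul_assoc, mul_comm (4 : ℝ), mul_assoc]
    refine mul_le_mul_of_nonneg_left ?_ (inv_pos.2 hZ).le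
    linarith
end Equivalence

/-! ## The registered stub from two named analytic inputs -/

section Residual

open Summit.AtomisticToContinuum.FouriersLaw.Cruxes.SuperadditiveResistance.FloatingProbeBypassLaplacian
  (exists_deviceResolventField)

/-- **`stub_kuboFrame` from two named analytic inputs.** The registered stub
`∀ …, ∃ g gb₁ gb₄, KuboFrame (pinnedChain ω₂ lam β γ) T N M g gb₁ gb₄` follows from
(R1) for each terminal `a`, an `L²(μ_T)` bound, uniform in `κ ∈ (0,1]`, on the `C² ∩ L²(μ_T)` solutions of
`κ g − L_dev g = p²_{s_a} − T` (they exist: landed `exists_deviceResolventField`; quantitative ergodicity of the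
four-thermostat device), and (R2) `S_K gb ∈ L²(μ_T)` for every classical `C² ∩ L²(μ_T)` end forward field
(`L²`-maximal hypoelliptic regularity at the probe momenta). Proof: (R1) + `helper_forwardFieldIffResolventBound` give the
four mean-zero classical forward fields, (R2) completes `IsForwardField` at the two ends, and the landed
`kuboFrame_kuboMatrix` builds the frame. -/
theorem stub_kuboFrame_of_resolventBound
    (hR1 : ∀ (ω₂ lam β γ T : ℝ), 0 < ω₂ → 0 < lam → 0 < β → 0 < γ → 0 < T → ∀ (N M : ℕ), 2 ≤ N → 2 ≤ M →
      ∀ a : Fin 4, ∃ C : ℝ, ∀ κ : ℝ, 0 < κ → κ ≤ 1 → ∀ g : PhaseSpace (N + M) → ℝ, ContDiff ℝ 2 g →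
        MemLp g 2 ((pinnedChain ω₂ lam β γ).gibbsMeasure (N + M) T) →
        (∀ x, κ * g x - deviceGenerator (pinnedChain ω₂ lam β γ) N M (fun _ => T) g x =
          kin (N + M) (termSite N M a) x - T) →
        ∫ x, g x ^ 2 ∂((pinnedChain ω₂ lam β γ).gibbsMeasure (N + M) T) ≤ C)
    (hR2 : ∀ (ω₂ lam β γ T : ℝ), 0 < ω₂ → 0 < lam → 0 < β → 0 < γ → 0 < T → ∀ (N M : ℕ), 2 ≤ N → 2 ≤ M →
      ∀ s : ℕ, (s = 0 ∨ s = N + M - 1) → ∀ gb : PhaseSpace (N + M) → ℝ, ContDiff ℝ 2 gb →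
        MemLp gb 2 ((pinnedChain ω₂ lam β γ).gibbsMeasure (N + M) T) →
        (∀ x, deviceGenerator (pinnedChain ω₂ lam β γ) N M (fun _ => T) gb x = -(kin (N + M) s x - T)) →
        MemLp (junctionOU T N M gb) 2 ((pinnedChain ω₂ lam β γ).gibbsMeasure (N + M) T)) :
    ∀ (ω₂ lam β γ T : ℝ), 0 < ω₂ → 0 < lam → 0 < β → 0 < γ → 0 < T →
      ∀ N M : ℕ, 2 ≤ N → 2 ≤ M →
        ∃ (g : Fin 4 → Fin 4 → ℝ) (gb₁ gb₄ : PhaseSpace (N + M) → ℝ),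
          KuboFrame (pinnedChain ω₂ lam β γ) T N M g gb₁ gb₄ := by
  intro ω₂ lam β γ T hω hl hβ hγ hT N M hN hM
  have hL : 0 < N + M := by omega
  have hlt : ∀ a, termSite N M a < N + M := fun a => by
    fin_cases a <;> simp [termSite] <;> omega
  -- resolvent families at the four terminal sites (choice over the landed existence theorem)
  have hex : ∀ (a : Fin 4) (κ : ℝ), 0 < κ → ∃ g : PhaseSpace (N + M) → ℝ, ContDiff ℝ 2 g ∧
      MemLp g 2 ((pinnedChain ω₂ lam β γ).gibbsMeasure (N + M) T) ∧
      ∀ x, κ * g x - deviceGenerator (pinnedChain ω₂ lam β γ) N M (fun _ => T) g x =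
        kin (N + M) (termSite N M a) x - T := by
    intro a κ hκ
    obtain ⟨g, hgC, hg2, hpde⟩ := exists_deviceResolventField hω hl.le hβ.le hγ hT hL (termSite N M a) hκ
    exact ⟨g, hgC.of_le (by norm_cast), hg2, fun x => hpde x⟩
  choose gfam hgfam using hex
  set g : Fin 4 → ℝ → PhaseSpace (N + M) → ℝ := fun a κ => if h : 0 < κ then gfam a κ h else fun _ => 0 with hgdef
  have hg : ∀ (a : Fin 4) (κ : ℝ), 0 < κ → ContDiff ℝ 2 (g a κ) ∧
      MemLp (g a κ) 2 ((pinnedChain ω₂ lam β γ).gibbsMeasure (N + M) T) ∧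
      ∀ x, κ * g a κ x - deviceGenerator (pinnedChain ω₂ lam β γ) N M (fun _ => T) (g a κ) x =
        kin (N + M) (termSite N M a) x - T := by
    intro a κ hκ
    have e : g a κ = gfam a κ hκ := by simp only [hgdef, dif_pos hκ]
    rw [e]
    exact hgfam a κ hκ
  -- (R1): the families are bounded; helper (C): classical mean-zero forward fields
  have hff : ∀ a : Fin 4, ∃ gb : PhaseSpace (N + M) → ℝ, ContDiff ℝ 2 gb ∧
      MemLp gb 2 ((pinnedChain ω₂ lam β γ).gibbsMeasure (N + M) T) ∧
      ∫ x, gb x ∂((pinnedChain ω₂ lam β γ).gibbsMeasure (N + M) T) = 0 ∧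
      ∀ x, deviceGenerator (pinnedChain ω₂ lam β γ) N M (fun _ => T) gb x = -(kin (N + M) (termSite N M a) x - T) := by
    intro a
    obtain ⟨C, hC⟩ := hR1 ω₂ lam β γ T hω hl hβ hγ hT N M hN hM a
    exact (helper_forwardFieldIffResolventBound ω₂ lam β γ T hω hl hβ hγ hT N M hN hM (termSite N M a) (hlt a)
      (g a) (hg a)).1 ⟨C, fun κ hκ hκ1 => hC κ hκ hκ1 (g a κ) (hg a κ hκ).1 (hg a κ hκ).2.1 (hg a κ hκ).2.2⟩
  choose gb hgbC hgbL2 hgbmean hgbpde using hff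
  -- (R2): the end fields are forward fields in the sense of `IsForwardField`
  have h0 : IsForwardField (pinnedChain ω₂ lam β γ) T N M 0 (gb 0) :=
    ⟨hgbC 0, hgbL2 0, hR2 ω₂ lam β γ T hω hl hβ hγ hT N M hN hM 0 (Or.inl rfl) (gb 0) (hgbC 0) (hgbL2 0) (hgbpde 0),
      hgbmean 0, hgbpde 0⟩
  have h3 : IsForwardField (pinnedChain ω₂ lam β γ) T N M (N + M - 1) (gb 3) :=
    ⟨hgbC 3, hgbL2 3, hR2 ω₂ lam β γ T hω hl hβ hγ hT N M hN hM (N + M - 1) (Or.inr rfl) (gb 3) (hgbC 3) (hgbL2 3)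
      (hgbpde 3), hgbmean 3, hgbpde 3⟩
  exact ⟨_, gb 0, gb 3, kuboFrame_kuboMatrix hω hl hβ hγ hT hN hM gb hgbC hgbL2 hgbpde h0 h3⟩

end Residual

end Summit.AtomisticToContinuum.FouriersLaw.Cruxes.SuperadditiveResistance.ThermaliseThenCutProbeInsertion

end
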